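import Summits.NavierStokesRegularity.NavierStokesRegularity.Theses.AxisymmetricExtremality
import Summits.NavierStokesRegularity.NavierStokesRegularity.Theorems.AxisymmetricExtremalityAxisymmetricKatoGlobalNoSwirlStratum
import Literature.Analysis.FluidPDE.AxisymmetricReflection
import Literature.Analysis.FluidPDE.KNSSLiouville

/-!
# Strategist s19-g10 sketch — typed companions of STRATEGY-CENSUS-s19.md (crux `AxisymmetricKatoGlobal`,
route `AxisymmetricExtremality`, item stmt-NavierStokesRegularity-15453).

Nothing here is a route item; these are the typed attempts the census refers to:
* §1 the weakest intermediate `NoAxisymMinimalBlowupDatum` (W0) that could replace the crux in `closes`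
  (`closes_of_w0`, proved) and the fact that the crux implies it (`w0_of_crux`, proved);
* §2 the O(2) observation: an axisymmetric minimal blow-up datum which is ALSO equivariant under the
  meridian reflection `reflY` cannot exist — a THEOREM over the tree (`noO2MinimalBlowupDatum`, proved from
  the landed no-swirl stratum and `IsAxisymmetric.hasNoSwirl_of_reflY_eq`), and the route-level bypass
  `closes_of_dihedral` (proved: `MinimalDatumDihedral → DihedralToO2 → NavierStokesRegularity`, no analytic crux);
* §3 the swirl-stratified split (assembly proved; the swirl piece is the crux again);
* §4 the strengthening S⁺ = the KNSS bounded-ancient axisymmetric Liouville conjecture WITH swirl (signature only);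
* §5 the negation target (signature only).
-/

open MeasureTheory Set
open Literature.Analysis.FluidPDE Literature.Analysis.FunctionSpaces

namespace Summit.NavierStokesRegularity.NavierStokesRegularity.Cruxes.AxisymmetricKatoGlobal.StrategistS19g10

open Summit.NavierStokesRegularity.NavierStokesRegularity.Theses.AxisymmetricExtremality
open Summit.NavierStokesRegularity.NavierStokesRegularity.Theorems.AxisymmetricKatoGlobal

/-- Local abbreviation for `ℝ³`. -/
abbrev R3 : Type := EuclideanSpace ℝ (Fin 3)
/-- Local abbreviation for `ℂ³`. -/
abbrev C3 : Type := EuclideanSpace ℂ (Fin 3)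

/-! ## §1 Weakest intermediate replacing the crux in `closes` -/

/-- W0: there is no axisymmetric Rusin–Šverák minimal blow-up datum (the only instance of the crux that
`closes` consumes). -/
def NoAxisymMinimalBlowupDatum : Prop :=
  ∀ ν : ℝ, 0 < ν → ∀ (u₀ : R3 → R3) (g : HomSobolev R3 C3 (1 / 2 : ℝ)),
    IsMinimalBlowupDatum ν u₀ g → IsAxisymmetric u₀ → False

/-- The crux implies W0 (trivially). -/
theorem w0_of_crux (h : AxisymmetricKatoGlobal) : NoAxisymMinimalBlowupDatum := by
  intro ν hν u₀ g hmin hax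
  obtain ⟨hL3, hrep, hdiv, -, hnot⟩ := hmin
  exact hnot (h ν hν u₀ g hL3 hrep hdiv hax)

/-- W0 suffices in place of the crux: the route's deciding theorem re-proved with W0 as third hypothesis. -/
theorem closes_of_w0 (h₂ : MinimalDatumPFold) (h₄ : PFoldToAxisymmetric) (h₀ : NoAxisymMinimalBlowupDatum) :
    NavierStokesRegularity := by
  show Literature.NS.NavierStokesExistenceSmoothR3
  intro ν hν u₀ hsm hdiv hdec
  by_contra hno
  obtain ⟨u₁, g, hmin, hax⟩ := h₄ ν hν (h₂ ν hν ⟨u₀, hsm, hdiv, hdec, hno⟩)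
  exact h₀ ν hν u₁ g hmin hax

/-! ## §2 The O(2) observation and the dihedral bypass (route level) -/

/-- THEOREM over the tree: no minimal blow-up datum is equivariant under the full group `O(2)` about the
axis (rotations `rotZ θ` and the meridian reflection `reflY`): such a field is axisymmetric WITHOUT swirl
(`IsAxisymmetric.hasNoSwirl_of_reflY_eq`) and the no-swirl critical stratum is landed
(`NoSwirlStratum.axisymmetricKatoGlobal_noSwirl_stratum`). -/
theorem noO2MinimalBlowupDatum :
    ∀ ν : ℝ, 0 < ν → ∀ (u₀ : R3 → R3) (g : HomSobolev R3 C3 (1 / 2 : ℝ)),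
      IsMinimalBlowupDatum ν u₀ g → IsAxisymmetric u₀ → (∀ x, u₀ (reflY x) = reflY (u₀ x)) → False := by
  intro ν hν u₀ g hmin hax hσ
  obtain ⟨hL3, -, hdiv, -, hnot⟩ := hmin
  exact hnot (NoSwirlStratum.axisymmetricKatoGlobal_noSwirl_stratum ν hν u₀ hL3 hdiv hax
    (hax.hasNoSwirl_of_reflY_eq hσ))

/-- The Clay-failure antecedent of `MinimalDatumPFold`, verbatim. -/
def ClayFails (ν : ℝ) : Prop :=
  ∃ v₀ : R3 → R3, ContDiff ℝ (⊤ : ℕ∞) v₀ ∧ NSWave0.IsDivFree v₀ ∧ HasRapidSpatialDecay v₀ ∧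
    ¬ ∃ (u : ℝ → R3 → R3) (p : ℝ → R3 → ℝ), IsSmoothOnHalfSpace u ∧ IsSmoothOnHalfSpace p ∧
      IsNavierStokesSolution ν 0 v₀ u p ∧ HasBoundedEnergy u

/-- Dihedral Smith output (would REPLACE `MinimalDatumPFold`, same technique class, same open status):
Clay failure at viscosity ν ⇒ for every N a minimal blow-up datum equivariant under the dihedral group
`D_p`, p ≥ max(N,2): the rotation by 2π/p about the x₂-axis AND the meridian reflection `reflY`.
(Smith theory for the 2-groups `D_{2^k}` needs only F₂-acyclicity of M/Sim.) -/
def MinimalDatumDihedral : Prop :=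
  ∀ ν : ℝ, 0 < ν → ClayFails ν → ∀ N : ℕ, ∃ p : ℕ, N ≤ p ∧ 2 ≤ p ∧
    ∃ (u₀ : R3 → R3) (g : HomSobolev R3 C3 (1 / 2 : ℝ)), IsMinimalBlowupDatum ν u₀ g ∧
      (∀ x, u₀ (rotZ (2 * Real.pi / p) x) = rotZ (2 * Real.pi / p) (u₀ x)) ∧
      (∀ x, u₀ (reflY x) = reflY (u₀ x))

/-- Compactness upgrade with the reflection carried along (would REPLACE `PFoldToAxisymmetric`; M-sized like
it: Rusin–Šverák compactness mod Sim, axis pinning as in the landed proof, and closedness of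
`reflY`-equivariance — the mirror planes contain the pinned axis). -/
def DihedralToO2 : Prop :=
  ∀ ν : ℝ, 0 < ν →
    (∀ N : ℕ, ∃ p : ℕ, N ≤ p ∧ 2 ≤ p ∧
      ∃ (u₀ : R3 → R3) (g : HomSobolev R3 C3 (1 / 2 : ℝ)), IsMinimalBlowupDatum ν u₀ g ∧
        (∀ x, u₀ (rotZ (2 * Real.pi / p) x) = rotZ (2 * Real.pi / p) (u₀ x)) ∧
        (∀ x, u₀ (reflY x) = reflY (u₀ x))) →
    ∃ (u₀ : R3 → R3) (g : HomSobolev R3 C3 (1 / 2 : ℝ)), IsMinimalBlowupDatum ν u₀ g ∧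
      IsAxisymmetric u₀ ∧ (∀ x, u₀ (reflY x) = reflY (u₀ x))

/-- ROUTE-LEVEL BYPASS (proved glue): with the symmetry group enlarged from `Z_p ⊂ SO(2)` to
`D_p ⊂ O(2)`, the analytic crux `AxisymmetricKatoGlobal` is not needed at all. -/
theorem closes_of_dihedral (hD : MinimalDatumDihedral) (hC : DihedralToO2) : NavierStokesRegularity := by
  show Literature.NS.NavierStokesExistenceSmoothR3
  intro ν hν u₀ hsm hdiv hdec
  by_contra hno
  obtain ⟨u₁, g, hmin, hax, hσ⟩ := hC ν hν (hD ν hν ⟨u₀, hsm, hdiv, hdec, hno⟩)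
  exact noO2MinimalBlowupDatum ν hν u₁ g hmin hax hσ

/-! ## §3 Decomposition attempt: swirl stratification (assembly proved, swirl piece = the crux) -/

/-- The crux restricted to data WITH swirl. -/
def SwirlPiece : Prop :=
  ∀ ν : ℝ, 0 < ν → ∀ (u₀ : R3 → R3) (g : HomSobolev R3 C3 (1 / 2 : ℝ)),
    MemLp u₀ 3 volume → g.Represents (EuclideanSpace.complexify ∘ u₀) → IsWeaklyDivFree u₀ →
    IsAxisymmetric u₀ → ¬ HasNoSwirl u₀ → HasGlobalKatoSolution ν u₀

/-- Assembly of the split `NoSwirlStratum (landed) ∧ SwirlPiece → crux`, proved. -/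
theorem crux_of_swirlPiece (h : SwirlPiece) : AxisymmetricKatoGlobal := by
  intro ν hν u₀ g hL3 hrep hdiv hax
  by_cases hsw : HasNoSwirl u₀
  · exact NoSwirlStratum.axisymmetricKatoGlobal_noSwirl_stratum ν hν u₀ hL3 hdiv hax hsw
  · exact h ν hν u₀ g hL3 hrep hdiv hax hsw

/-- … and conversely the crux gives the piece: the split is not a reduction. -/
theorem swirlPiece_of_crux (h : AxisymmetricKatoGlobal) : SwirlPiece :=
  fun ν hν u₀ g hL3 hrep hdiv hax _ => h ν hν u₀ g hL3 hrep hdiv hax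

/-! ## §4 Strengthening S⁺: the KNSS Liouville conjecture, axisymmetric WITH (bounded) swirl -/

/-- S⁺ (KNSS 2009 conjecture, open; Zhang's review arXiv:2101.04905 §3 p.10–12): a bounded weak ancient
solution on ℝ³ × (−∞,0) (ν = 1) which is axisymmetric and has bounded swirl `Γ = r u_θ` is a bounded
function of time times `e_z`. Known: no swirl (KNSS Thm 5.2, tree `KNSS2009_liouville_axisymmetric_no_swirl`),
`|u| ≤ C/r` (Thm 5.3), `Γ ∈ L^∞_t L^p_x`, p < ∞ (Lei–Zhang–Zhao 2017), z-periodic (Lei–Ren–Zhang 2022). -/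
def AxisymAncientLiouvilleSwirl : Prop :=
  ∀ ⦃u : ℝ → R3 → R3⦄, IsBoundedWeakNSSolutionOn (Iio 0) isOpen_Iio 1 u →
    (∀ θ : ℝ, ∀ᵐ t ∂(volume.restrict (Iio (0 : ℝ))),
      (fun x => u t (rotZ θ x)) =ᵐ[volume] fun x => rotZ θ (u t x)) →
    (∃ C : ℝ, ∀ᵐ t ∂(volume.restrict (Iio (0 : ℝ))), ∀ᵐ x ∂volume, |swirl (u t) x| ≤ C) →
    ∃ b : ℝ → ℝ, Measurable b ∧ (∃ C : ℝ, ∀ t, |b t| ≤ C) ∧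
      ∀ᵐ t ∂(volume.restrict (Iio (0 : ℝ))), u t =ᵐ[volume] fun _ => b t • eZ

/-! ## §5 Negation target -/

/-- ¬crux, unfolded: an axisymmetric critical datum without a global Kato solution at some ν > 0. -/
def AxisymBlowupDatumExists : Prop :=
  ∃ ν : ℝ, 0 < ν ∧ ∃ (u₀ : R3 → R3) (g : HomSobolev R3 C3 (1 / 2 : ℝ)),
    MemLp u₀ 3 volume ∧ g.Represents (EuclideanSpace.complexify ∘ u₀) ∧ IsWeaklyDivFree u₀ ∧
    IsAxisymmetric u₀ ∧ ¬ HasGlobalKatoSolution ν u₀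

theorem not_crux_iff : ¬ AxisymmetricKatoGlobal ↔ AxisymBlowupDatumExists := by
  constructor
  · intro h
    by_contra hne
    apply h
    intro ν hν u₀ g hL3 hrep hdiv hax
    by_contra hno
    exact hne ⟨ν, hν, u₀, g, hL3, hrep, hdiv, hax, hno⟩
  · rintro ⟨ν, hν, u₀, g, hL3, hrep, hdiv, hax, hno⟩ h
    exact hno (h ν hν u₀ g hL3 hrep hdiv hax)

end Summit.NavierStokesRegularity.NavierStokesRegularity.Cruxes.AxisymmetricKatoGlobal.StrategistS19g10
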